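import Literature.AnabelianGeometry.EtaleTheta.Discharge.Sec3Prop34iDivPlus
import Literature.AlgebraicGeometry.Frobenioids.PiNatFixedPoints
import HarnessLib

/-!
# [EtTh] Prop. 3.4 (i) for the GALOIS-INVARIANT monoids `Div⁺(Z^log_∞)^Γ` — at the typed interface
# `LogDivisorModel`, for EVERY group `Γ` of monoid automorphisms of `DIV⁺(Z^log_∞)`, in the weak vocabulary of record

Mochizuki, *The étale theta function and its Frobenioid-theoretic manifestations*, Publ. RIMS **45** (2009), §3,
Prop. 3.4 (i) PDF p. 74 (printed 300): "`Φ₀(Y^log)`, as well as each of the monoids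
`Div⁺(Z^log_∞)^{Gal(Z^log_∞/Y^log)}` appearing in the inductive limit defining `Φ₀(Y^log)`, is perf-factorial";
proof: "The fact that `M` is perf-factorial then follows immediately from Proposition 3.2, (i)"; Rmk. 3.3.1 p. 73:
"the set of primes of the monoid `Div⁺(Z^log_∞)^{Gal(Z^log_∞/Y^log)}` … is in natural bijective correspondence with
the set of `Gal(Z^log_∞/Y^log)`-orbits of prime log-divisors on `Z^log_∞`" [cite: MochizukiEtTh2009, Prop 3.4 p.74].

abc-iut cell, block C / W6 cone prover abc-iut-w6-d057, W6-TRANCHE-2 row **EtTh:Prop3.4(i)**, part (B); sequel of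
`Sec3Prop34iDivPlus.lean` (p433424: the member `Div⁺(Z^log_∞)` itself) over the engines
`Frobenioids/PerfFactorialWeakGroupSaturated.lean` (p432632) and `Frobenioids/PiNatFixedPoints.lean` (p433433).
PROOF-ONLY (theorems only).  The Galois group `Gal(Z^log_∞/Y^log)` acts on log-divisors by permuting the prime
log-divisors (cusps, irreducible components of the special fibre); at the interface `LogDivisorModel` (which carries
no Galois action) we therefore quantify over an ARBITRARY subgroup `Γ ≤ Aut(DIV⁺(Z^log_∞))` of monoid automorphisms —
every such automorphism permutes the prime log-divisors (`PiNat.exists_map_single_one`) — and read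
`Div⁺(Z^log_∞)^Γ` as the monoid of `Γ`-invariant effective Cartier log-divisors, i.e. the submonoid
`(Div⁺ ∩ DIV⁺) ∩ (DIV⁺)^Γ` of Mathlib's `FixedPoints.submonoid Γ ↥Z.DIVplus`:

* `LogDivisorModel.isPerfFactorialWeak_fixedPoints_DIVplus`, `…isZMonoprime_submonoid_primes_fixedPoints_DIVplus`,
  `…rlfCofinal_fixedPoints_DIVplus` — `(DIV⁺)^Γ ≅ ∏_{orbits} ℤ≥0` is weakly perf-factorial with `ℤ`-monoprime
  components and cofinal perfection (Rmk. 3.3.1);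
* `LogDivisorModel.isGroupSaturated_Divplus_fixedPoints`, `…mem_perfSaturation_Divplus_fixedPoints` —
  `Div⁺ ∩ (DIV⁺)^Γ` is group-saturated and perf-dense in `(DIV⁺)^Γ` (Def. 3.1 (i), Prop. 3.2 (i));
* **`LogDivisorModel.isPerfFactorialCof_Divplus_fixedPoints`**, **`LogDivisorModel.prop34_i_Divplus_fixedPoints`** —
  `Div⁺(Z^log_∞)^Γ` is weakly perf-factorial with cofinal perfection, i.e. `treeMonoidVocabWeak.IsPerfFactorial`,
  for every `LogDivisorModel` and every `Γ`; and `…isZMonoprime_submonoid_primes_Divplus_fixedPoints`.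

HONEST FRAMING: as in `Sec3Prop34iDivPlus.lean` — the weak reading of "perf-factorial" is the cell's (F-L2d2-1,
F-L2d2-2; the printed [FrdI] Def. 2.4 (i)(d) reading is refuted for infinite index sets); the inductive limit
`Φ₀(Y^log)` itself is not constructed in the tree and is not treated; `LogDivisorModel` is an interface, nothing
asserts it arises from a curve; no side is taken on [IUTchIII] Cor. 3.12; typed ≠ proved for anything else.
-/

noncomputable section

namespace Literature.AnabelianGeometry.EtaleTheta

open Literature.AlgebraicGeometry.Frobenioids Function

universe u

namespace LogDivisorModel

variable (Z : LogDivisorModel.{u}) (Γ : Subgroup (MulAut ↥Z.DIVplus))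

/-! ### `(DIV⁺)^Γ ≅ ∏_{orbits} ℤ≥0` -/

/-- `(DIV⁺(Z^log_∞))^Γ` is isomorphic to the invariants of `∏_{Cusp ⊔ Comp} ℤ≥0` under a group of its
automorphisms (transport along Def. 3.1 (i)'s `DIV⁺ ≅ ∏ ℤ≥0`). [cite: MochizukiEtTh2009, Def 3.1 p.70] -/
theorem exists_fixedPoints_DIVplus_congr :
    ∃ Γ₀ : Subgroup (MulAut (Multiplicative (Z.Cusp ⊕ Z.Comp → ℕ))),
      Nonempty (↥(FixedPoints.submonoid Γ ↥Z.DIVplus) ≃*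
        ↥(FixedPoints.submonoid Γ₀ (Multiplicative (Z.Cusp ⊕ Z.Comp → ℕ)))) := by
  obtain ⟨e⟩ := Z.nonempty_piNatEquivDIVplus
  exact exists_fixedPoints_congr e Γ

/-- **`(DIV⁺(Z^log_∞))^Γ` is weakly perf-factorial** (`≅ ∏_{orbits} ℤ≥0`). [cite: MochizukiEtTh2009, Prop 3.4 p.74] -/
theorem isPerfFactorialWeak_fixedPoints_DIVplus : IsPerfFactorialWeak ↥(FixedPoints.submonoid Γ ↥Z.DIVplus) := by
  obtain ⟨Γ₀, ⟨e⟩⟩ := Z.exists_fixedPoints_DIVplus_congr Γ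
  exact (PiNat.isPerfFactorialWeak_fixedPoints Γ₀).of_mulEquiv e.symm

/-- **The prime components of `(DIV⁺(Z^log_∞))^Γ` are `ℤ`-monoprime** (one per `Γ`-orbit of prime log-divisors,
Rmk. 3.3.1). [cite: MochizukiEtTh2009, Rmk 3.3.1 p.73] -/
theorem isZMonoprime_submonoid_primes_fixedPoints_DIVplus (𝔭 : Primes ↥(FixedPoints.submonoid Γ ↥Z.DIVplus)) :
    IsZMonoprime ↥𝔭.submonoid := by
  obtain ⟨Γ₀, ⟨e⟩⟩ := Z.exists_fixedPoints_DIVplus_congr Γ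
  exact (PiNat.isZMonoprime_submonoid_primes_fixedPoints Γ₀ (Primes.congr e 𝔭)).of_mulEquiv
    (Primes.submonoidCongr e.symm (Primes.congr e 𝔭) 𝔭 (Primes.congr_symm_apply_congr e 𝔭))

/-- **(d_cof) for `(DIV⁺(Z^log_∞))^Γ`.** [cite: MochizukiEtTh2009, Lem 3.5 p.75] -/
theorem rlfCofinal_fixedPoints_DIVplus :
    ∀ x : (Z.isPerfFactorialWeak_fixedPoints_DIVplus Γ).Rlf, ∃ b,
      x ∣ (Z.isPerfFactorialWeak_fixedPoints_DIVplus Γ).toRealification b := by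
  obtain ⟨Γ₀, ⟨e⟩⟩ := Z.exists_fixedPoints_DIVplus_congr Γ
  exact IsPerfFactorialWeak.rlfCofinal_of_mulEquiv e.symm (PiNat.isPerfFactorialWeak_fixedPoints Γ₀)
    (PiNat.rlfCofinal_fixedPoints Γ₀) (Z.isPerfFactorialWeak_fixedPoints_DIVplus Γ)

/-! ### `Div⁺(Z^log_∞)^Γ = Div⁺ ∩ (DIV⁺)^Γ` inside `(DIV⁺)^Γ`: group-saturated and perf-dense -/

/-- Membership in `Div⁺(Z^log_∞)^Γ`: a `Γ`-invariant effective log-divisor lies in it iff it is Cartier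
(lies in `Div⁺`). [cite: MochizukiEtTh2009, Def 3.1 p.70] -/
theorem mem_Divplus_fixedPoints_iff (x : ↥(FixedPoints.submonoid Γ ↥Z.DIVplus)) :
    x ∈ (Z.Divplus.comap Z.DIVplus.subtype).comap (FixedPoints.submonoid Γ ↥Z.DIVplus).subtype ↔
      ((x : ↥Z.DIVplus) : Z.DIV) ∈ Z.Divplus := Iff.rfl

/-- Membership in `(DIV⁺)^Γ`: invariance under every `γ ∈ Γ`. [cite: MochizukiEtTh2009, Rmk 3.3.1 p.73] -/
theorem mem_fixedPoints_DIVplus_iff (x : ↥Z.DIVplus) :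
    x ∈ FixedPoints.submonoid Γ ↥Z.DIVplus ↔ ∀ γ ∈ Γ, γ x = x := by
  rw [FixedPoints.mem_submonoid]
  exact ⟨fun h γ hγ => h ⟨γ, hγ⟩, fun h γ => h γ.1 γ.2⟩

/-- **`Div⁺(Z^log_∞)^Γ` is GROUP-SATURATED in `(DIV⁺)^Γ`** (a quotient of Cartier divisors is Cartier).
[cite: MochizukiEtTh2009, Def 3.1 p.70] -/
theorem isGroupSaturated_Divplus_fixedPoints :
    IsGroupSaturated ((Z.Divplus.comap Z.DIVplus.subtype).comap (FixedPoints.submonoid Γ ↥Z.DIVplus).subtype) := by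
  rw [isGroupSaturated_iff']
  intro q a ha b hb h
  rw [Submonoid.mem_comap] at ha hb ⊢
  exact (isGroupSaturated_iff' _).mp Z.isGroupSaturated_Divplus_comap _ _ ha _ hb
    (by rw [← map_mul, h])

/-- **`Div⁺(Z^log_∞)^Γ` is PERF-DENSE in `(DIV⁺)^Γ`** (Prop. 3.2 (i): `n · DIV⁺ ⊆ Div⁺`, and a power of an invariant
is invariant). [cite: MochizukiEtTh2009, Prop 3.2 p.70] -/
theorem mem_perfSaturation_Divplus_fixedPoints (x : ↥(FixedPoints.submonoid Γ ↥Z.DIVplus)) :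
    x ∈ perfSaturation ((Z.Divplus.comap Z.DIVplus.subtype).comap (FixedPoints.submonoid Γ ↥Z.DIVplus).subtype) := by
  obtain ⟨n, hn⟩ := (mem_perfSaturation_iff _ _).mp (Z.mem_perfSaturation_Divplus_comap (x : ↥Z.DIVplus))
  rw [mem_perfSaturation_iff]
  refine ⟨n, ?_⟩
  rw [Submonoid.mem_comap, Submonoid.coe_subtype, SubmonoidClass.coe_pow]
  exact hn

/-! ### Prop. 3.4 (i) for `Div⁺(Z^log_∞)^Γ` -/

/-- **`Div⁺(Z^log_∞)^Γ` is weakly perf-factorial** (engine `GroupSaturatedSubmonoid.isPerfFactorialWeak` inside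
`(DIV⁺)^Γ ≅ ∏_{orbits} ℤ≥0`). [cite: MochizukiEtTh2009, Prop 3.4 p.74] -/
theorem isPerfFactorialWeak_Divplus_fixedPoints :
    IsPerfFactorialWeak ↥((Z.Divplus.comap Z.DIVplus.subtype).comap (FixedPoints.submonoid Γ ↥Z.DIVplus).subtype) :=
  GroupSaturatedSubmonoid.isPerfFactorialWeak (Z.isPerfFactorialWeak_fixedPoints_DIVplus Γ)
    (Z.isZMonoprime_submonoid_primes_fixedPoints_DIVplus Γ) (Z.isGroupSaturated_Divplus_fixedPoints Γ)
    (Z.mem_perfSaturation_Divplus_fixedPoints Γ)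

/-- **Every prime component of `Div⁺(Z^log_∞)^Γ` is `ℤ`-monoprime** (primes = `Γ`-orbits of prime log-divisors,
Rmk. 3.3.1). [cite: MochizukiEtTh2009, Rmk 3.3.1 p.73] -/
theorem isZMonoprime_submonoid_primes_Divplus_fixedPoints
    (𝔭 : Primes ↥((Z.Divplus.comap Z.DIVplus.subtype).comap (FixedPoints.submonoid Γ ↥Z.DIVplus).subtype)) :
    IsZMonoprime ↥𝔭.submonoid :=
  GroupSaturatedSubmonoid.isZMonoprime_submonoid_primes
    (Z.isPerfFactorialWeak_fixedPoints_DIVplus Γ).isDivisorial.isSharp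
    (Z.isZMonoprime_submonoid_primes_fixedPoints_DIVplus Γ) (Z.isGroupSaturated_Divplus_fixedPoints Γ)
    (Z.mem_perfSaturation_Divplus_fixedPoints Γ) 𝔭

/-- **`Div⁺(Z^log_∞)^Γ` is weakly perf-factorial WITH COFINAL PERFECTION.** [cite: MochizukiEtTh2009, Prop 3.4 p.74] -/
theorem isPerfFactorialCof_Divplus_fixedPoints :
    IsPerfFactorialCof ↥((Z.Divplus.comap Z.DIVplus.subtype).comap (FixedPoints.submonoid Γ ↥Z.DIVplus).subtype) :=
  ⟨Z.isPerfFactorialWeak_Divplus_fixedPoints Γ,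
    GroupSaturatedSubmonoid.rlfCofinal (Z.isPerfFactorialWeak_fixedPoints_DIVplus Γ)
      (Z.rlfCofinal_fixedPoints_DIVplus Γ) (Z.mem_perfSaturation_Divplus_fixedPoints Γ)
      (Z.isPerfFactorialWeak_Divplus_fixedPoints Γ)⟩

/-- **[EtTh] Prop. 3.4 (i) for `Div⁺(Z^log_∞)^Γ`, IN THE WEAK VOCABULARY OF RECORD**: "each of the monoids
`Div⁺(Z^log_∞)^{Gal(Z^log_∞/Y^log)}` appearing in the inductive limit defining `Φ₀(Y^log)`, is perf-factorial" read
with `treeMonoidVocabWeak` (perf-factorial := `IsPerfFactorialCof`), for every `LogDivisorModel` and EVERY group `Γ`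
of monoid automorphisms of `DIV⁺(Z^log_∞)` (the Galois group acts through such automorphisms, permuting the prime
log-divisors) — by the printed route "follows immediately from Proposition 3.2, (i)".
[cite: MochizukiEtTh2009, Prop 3.4 p.74] -/
theorem prop34_i_Divplus_fixedPoints :
    treeMonoidVocabWeak.IsPerfFactorial
      ↥((Z.Divplus.comap Z.DIVplus.subtype).comap (FixedPoints.submonoid Γ ↥Z.DIVplus).subtype) :=
  (treeMonoidVocabWeak_isPerfFactorial _).mpr (Z.isPerfFactorialCof_Divplus_fixedPoints Γ)

end LogDivisorModel

end Literature.AnabelianGeometry.EtaleTheta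

end
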